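import Mathlib.FieldTheory.PrimitiveElement
import Mathlib.FieldTheory.Minpoly.Field
import Literature.NumberTheory.Transcendental.RoySmallValueEstimatesProjPlaneProofs
import Literature.NumberTheory.Transcendental.RoySmallValueEstimatesWeilTranslateProofs
import Literature.NumberTheory.Transcendental.RoySmallValueEstimatesAbsHeightProofs
import HarnessLib

/-!
# Small value estimates at rational translates (Nguyen–Roy 2016) — proofs, XVI: algebraic points of `ℙ²(ℂ)`, their conjugates and translates

Sixteenth proofs file towards `Literature.NumberTheory.Transcendental.nguyenRoy2016_thm_1` (Nguyen–Roy,
IJNT 12 (2016) = arXiv:1412.5163). Everything here is PROVED; no named facts. §4 of the paper works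
with zero-dimensional `ℚ`-subvarieties `Z` of `ℙ²`; such a `Z` is the set of conjugates over `ℚ` of
any of its points `α ∈ ℙ²(ℚ̄)`, `deg Z = [ℚ(α):ℚ]`, and `τZ` is again one, with the conjugates of
`τα` as points. This file realises these objects for the hypothesis structure
`NguyenRoy.EndgameData` (whose `V` will be the type `AlgPt` of algebraic points, `pts` the
conjugates, `deg = #pts`):

* `nrm v`, `nv p` — the normalised homogeneous coordinates of `v ∈ ℂ³ ∖ 0`, `p ∈ ℙ²(ℂ)` (divide by
  the first non-zero coordinate); `Kp p = ℚ(nv p) ⊆ ℂ`, the field of definition of `p`, with the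
  coordinates `ap p ∈ (Kp p)³`; for `p` algebraic (`AlgPt`) it is a number field and
  `deg p = [Kp p : ℚ]`;
* `conj P` — the conjugates `[φ(ap p)]`, `φ : Kp p → ℂ`, of an algebraic point, a `Finset` with
  `P ∈ conj P`, **`card_conj : #conj P = deg P`** (distinct embeddings give distinct points since a
  coordinate of `ap p` is `1` and the coordinates generate `Kp p`), all of the same absolute height
  (`habs_of_mem_conj`);
* `conj_eq_image` — the conjugates may be computed from any coordinates `b ∈ E³` of `p` over a
  finite extension `E ⊆ ℂ` of `ℚ` with `E ≤ Kp p`;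
* `mk_eq_mk_of_minors_eq_zero`, `eq_of_pdist_eq_zero` — points at projective distance `0` are equal;
* translates: `isAlgPt_tauP`, `tauA` (the translate of an algebraic point), `Kp_le_Kp_tauA` and
  **`conj_tauA : conj (τⁱP) = (conj P).image τⁱ`** (the points of `τZ` are the translates of the
  points of `Z`), `deg_tauA : deg (τⁱP) = deg P`.

## References

* [NguyenRoy2016] N. A. V. Nguyen, D. Roy, IJNT 12 (2016) 1273–1293 = arXiv:1412.5163, §4
  (zero-dimensional subvarieties, their points, degrees, translates; proof of Lemma 11).
-/

noncomputable section

open Height Module Matrix Finset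
open Literature.NumberTheory.Transcendental.Nesterenko
open scoped Classical

namespace Literature.NumberTheory.Transcendental

namespace NguyenRoy

/-! ### Normalised homogeneous coordinates -/

/-- The index of the first non-zero coordinate of `v ∈ ℂ³` (`2` if `v₀ = v₁ = 0`). [folklore] -/
def pivot (v : V3) : Fin 3 := if v 0 ≠ 0 then 0 else if v 1 ≠ 0 then 1 else 2

/-- The three possible shapes of the pivot. [folklore] -/
theorem pivot_cases (v : V3) :
    (pivot v = 0 ∧ v 0 ≠ 0) ∨ (pivot v = 1 ∧ v 0 = 0 ∧ v 1 ≠ 0) ∨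
      (pivot v = 2 ∧ v 0 = 0 ∧ v 1 = 0) := by
  unfold pivot
  split_ifs with h0 h1
  · exact Or.inl ⟨rfl, h0⟩
  · push Not at h0; exact Or.inr (Or.inl ⟨rfl, h0, h1⟩)
  · push Not at h0 h1; exact Or.inr (Or.inr ⟨rfl, h0, h1⟩)

/-- The pivot coordinate of a non-zero vector is non-zero. [folklore] -/
theorem apply_pivot_ne_zero {v : V3} (hv : v ≠ 0) : v (pivot v) ≠ 0 := by
  rcases pivot_cases v with ⟨h, h0⟩ | ⟨h, h0, h1⟩ | ⟨h, h0, h1⟩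
  · rwa [h]
  · rwa [h]
  · rw [h]
    intro h2
    apply hv
    funext j
    fin_cases j
    · exact h0
    · exact h1
    · exact h2

/-- The pivot only depends on the zero pattern: it is invariant under non-zero scalars. [folklore] -/
theorem pivot_smul {c : ℂ} (hc : c ≠ 0) (v : V3) : pivot (c • v) = pivot v := by
  unfold pivot
  simp [hc]

/-- The pivot is invariant under an injective map fixing `0`: for a ring homomorphism `φ`,
`pivot (φ ∘ u) = pivot u`. [folklore] -/
theorem pivot_map {E : Type*} [Field E] (φ : E →+* ℂ) (u : Fin 3 → E) :
    pivot (fun j => φ (u j)) = (if u 0 ≠ 0 then 0 else if u 1 ≠ 0 then 1 else 2 : Fin 3) := by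
  unfold pivot
  simp [map_ne_zero_iff φ φ.injective]

/-- The normalised coordinates `v / v_{pivot}`. [folklore] -/
def nrm (v : V3) : V3 := fun j => v j / v (pivot v)

/-- The pivot coordinate of `nrm v` is `1`. [folklore] -/
theorem nrm_pivot {v : V3} (hv : v ≠ 0) : nrm v (pivot v) = 1 :=
  div_self (apply_pivot_ne_zero hv)

/-- `nrm (c • v) = nrm v`. [folklore] -/
theorem nrm_smul {c : ℂ} (hc : c ≠ 0) (v : V3) : nrm (c • v) = nrm v := by
  funext j
  simp only [nrm, pivot_smul hc, Pi.smul_apply, smul_eq_mul]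
  rw [mul_div_mul_left _ _ hc]

/-- `v = v_{pivot} • nrm v`. [folklore] -/
theorem smul_nrm {v : V3} (hv : v ≠ 0) : v (pivot v) • nrm v = v := by
  funext j
  simp only [nrm, Pi.smul_apply, smul_eq_mul]
  rw [mul_div_cancel₀ _ (apply_pivot_ne_zero hv)]

/-- `nrm v ≠ 0`. [folklore] -/
theorem nrm_ne_zero {v : V3} (hv : v ≠ 0) : nrm v ≠ 0 := fun h => by
  have := congrFun h (pivot v)
  rw [nrm_pivot hv] at this
  exact one_ne_zero this

/-- `[nrm v] = [v]`. [folklore] -/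
theorem mk_nrm {v : V3} (hv : v ≠ 0) :
    Projectivization.mk ℂ (nrm v) (nrm_ne_zero hv) = Projectivization.mk ℂ v hv := by
  rw [Projectivization.mk_eq_mk_iff']
  refine ⟨(v (pivot v))⁻¹, funext fun j => ?_⟩
  simp only [nrm, Pi.smul_apply, smul_eq_mul]
  rw [div_eq_inv_mul]

/-- Equal vectors give equal points. [folklore] -/
theorem mk_congr {v w : V3} (hv : v ≠ 0) (hw : w ≠ 0) (h : v = w) :
    Projectivization.mk ℂ v hv = Projectivization.mk ℂ w hw := by
  subst h; rfl

/-- The normalised coordinates of a point of `ℙ²(ℂ)`. [folklore] -/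
def nv (p : PPt) : V3 := nrm p.rep

/-- The pivot of a point. [folklore] -/
def piv (p : PPt) : Fin 3 := pivot p.rep

/-- `nv p ≠ 0`. [folklore] -/
theorem nv_ne_zero (p : PPt) : nv p ≠ 0 := nrm_ne_zero p.rep_nonzero

/-- `[nv p] = p`. [folklore] -/
theorem mk_nv (p : PPt) : Projectivization.mk ℂ (nv p) (nv_ne_zero p) = p := by
  have h := mk_nrm p.rep_nonzero
  rw [Projectivization.mk_rep] at h
  exact h

/-- `nv p (piv p) = 1`. [folklore] -/
theorem nv_piv (p : PPt) : nv p (piv p) = 1 := nrm_pivot p.rep_nonzero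

/-- `nv [v] = nrm v` and `piv [v] = pivot v`. [folklore] -/
theorem nv_mk {v : V3} (hv : v ≠ 0) :
    nv (Projectivization.mk ℂ v hv) = nrm v ∧ piv (Projectivization.mk ℂ v hv) = pivot v := by
  obtain ⟨c, hc⟩ := Projectivization.exists_smul_eq_mk_rep ℂ v hv
  rw [nv, piv, ← hc, Units.smul_def, nrm_smul c.ne_zero, pivot_smul c.ne_zero]
  exact ⟨rfl, rfl⟩

/-! ### The field of definition and the coordinates of a point -/

/-- The field `ℚ(p) ⊆ ℂ` generated by the normalised coordinates of `p`.
[cite: NguyenRoy2016, §4 (the residue field of a closed point)] -/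
def Kp (p : PPt) : IntermediateField ℚ ℂ := IntermediateField.adjoin ℚ (Set.range (nv p))

/-- The normalised coordinates as elements of `ℚ(p)`. [folklore] -/
def ap (p : PPt) : Fin 3 → Kp p :=
  fun j => ⟨nv p j, IntermediateField.subset_adjoin _ _ ⟨j, rfl⟩⟩

/-- `(ap p j : ℂ) = nv p j`. [folklore] -/
@[simp] theorem coe_ap (p : PPt) (j : Fin 3) : ((ap p j : Kp p) : ℂ) = nv p j := rfl

/-- `ap p (piv p) = 1`. [folklore] -/
theorem ap_piv (p : PPt) : ap p (piv p) = 1 := Subtype.ext (by simp [nv_piv])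

/-- The coordinate vector `(ap p : ℂ³) = nv p` is non-zero. [folklore] -/
theorem coe_ap_ne_zero (p : PPt) : (fun j => ((ap p j : Kp p) : ℂ)) ≠ 0 := by
  simpa using nv_ne_zero p

/-- A ring homomorphism applied to `ap p` gives a non-zero vector. [folklore] -/
theorem map_ap_ne_zero {p : PPt} {R : Type*} [Field R] (φ : Kp p →+* R) :
    (fun j => φ (ap p j)) ≠ 0 := fun h => by
  have := congrFun h (piv p)
  rw [ap_piv, map_one] at this
  exact one_ne_zero this

/-! ### Algebraic points -/

/-- For an algebraic point, the normalised coordinates are algebraic: `ℚ(p)` is a number field.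
[cite: NguyenRoy2016, §4] -/
theorem finiteDimensional_Kp {p : PPt} (h : IsAlgPt p) : FiniteDimensional ℚ (Kp p) := by
  obtain ⟨P⟩ := h
  have hrep : nv p = nrm (fun j => P.ι (P.a j)) := by
    have := (nv_mk P.ne_zero).1
    rwa [P.mk_eq] at this
  apply IntermediateField.finiteDimensional_adjoin
  rintro x ⟨j, rfl⟩
  rw [hrep]
  simp only [nrm]
  rw [← map_div₀]
  exact (Algebra.IsIntegral.isIntegral (R := ℚ) _).map P.ι.toRatAlgHom

/-- The type of algebraic points of `ℙ²(ℂ)` (the `V` of `EndgameData`: a zero-dimensional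
`ℚ`-subvariety is recorded by one of its points). [cite: NguyenRoy2016, §4] -/
abbrev AlgPt : Type := {p : PPt // IsAlgPt p}

namespace AlgPt

variable (P : AlgPt)

/-- `ℚ(P)` is finite-dimensional for an algebraic point. [folklore] -/
instance : FiniteDimensional ℚ (Kp P.1) := finiteDimensional_Kp P.2

/-- `ℚ(P)` is a number field for an algebraic point. [folklore] -/
instance : NumberField (Kp P.1) := NFPres.numberField_of_intermediateField _

/-- The canonical presentation `(ℚ(p), ⊆, ap p)` of an algebraic point. [folklore] -/
def pres : NFPres P.1 :=
  { K := Kp P.1, ι := (algebraMap (Kp P.1) ℂ), a := ap P.1,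
    ne_zero := coe_ap_ne_zero P.1
    mk_eq := (mk_congr _ _ (funext fun _ => rfl)).trans (mk_nv P.1) }

/-- The degree `deg p = [ℚ(p):ℚ]`. [cite: NguyenRoy2016, §4 (deg Z)] -/
def deg : ℕ := finrank ℚ (Kp P.1)

/-- `1 ≤ deg`. [folklore] -/
theorem one_le_deg : 1 ≤ P.deg := Nat.one_le_iff_ne_zero.mpr Module.finrank_pos.ne'

/-- `h_abs(p) = h_{ℚ(p)}(ap p)/deg p`. [cite: NguyenRoy2016, §4] -/
theorem habs_eq_logHeight_ap : habs P.1 = logHeight (ap P.1) / P.deg := habs_eq P.pres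

/-- The conjugate point `[φ(ap p)]` for an embedding `φ : ℚ(p) → ℂ`. [cite: NguyenRoy2016, §4] -/
def embPt (φ : Kp P.1 →ₐ[ℚ] ℂ) : PPt :=
  Projectivization.mk ℂ (fun j => φ (ap P.1 j)) (map_ap_ne_zero φ.toRingHom)

/-- The conjugates of `P`: the points of the zero-dimensional `ℚ`-subvariety `Z ∋ P`.
[cite: NguyenRoy2016, §4] -/
def conj : Finset PPt := Finset.univ.image P.embPt

/-- `P` is one of its conjugates. [folklore] -/
theorem self_mem_conj : P.1 ∈ P.conj := by
  refine Finset.mem_image.mpr ⟨(Kp P.1).val, Finset.mem_univ _, ?_⟩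
  exact (mk_congr _ _ (funext fun _ => rfl)).trans (mk_nv P.1)

/-- `conj P` is non-empty. [folklore] -/
theorem conj_nonempty : P.conj.Nonempty := ⟨P.1, P.self_mem_conj⟩

/-- Distinct embeddings give distinct conjugates (a coordinate of `ap p` is `1`, and the
coordinates generate `ℚ(p)`). [cite: NguyenRoy2016, §4] -/
theorem embPt_injective : Function.Injective P.embPt := by
  intro φ ψ h
  obtain ⟨c, hc⟩ := (Projectivization.mk_eq_mk_iff' ℂ _ _ _ _).mp h
  -- `hc : c • (ψ ∘ ap) = φ ∘ ap`; at the pivot both are `1`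
  have hc1 : c = 1 := by
    have := congrFun hc (piv P.1)
    simp only [Pi.smul_apply, smul_eq_mul] at this
    rwa [ap_piv, map_one, map_one, mul_one] at this
  rw [hc1, one_smul] at hc
  refine IntermediateField.algHom_ext_of_eq_adjoin ℚ (S := Kp P.1) (s := Set.range (nv P.1)) rfl ?_
  rintro x ⟨j, rfl⟩
  exact (congrFun hc j).symm

/-- **`#conj P = deg P`.** [cite: NguyenRoy2016, §4 (deg Z = number of points of Z)] -/
theorem card_conj : P.conj.card = P.deg := by
  rw [conj, Finset.card_image_of_injective _ P.embPt_injective, Finset.card_univ, deg]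
  exact AlgHom.card ℚ (Kp P.1) ℂ

/-- A conjugate has the presentation `(ℚ(p), φ, ap p)`. [folklore] -/
def presConj (φ : Kp P.1 →ₐ[ℚ] ℂ) : NFPres (P.embPt φ) :=
  { K := Kp P.1, ι := φ.toRingHom, a := ap P.1, ne_zero := map_ap_ne_zero φ.toRingHom, mk_eq := rfl }

/-- Conjugates are algebraic. [folklore] -/
theorem isAlgPt_of_mem_conj {q : PPt} (hq : q ∈ P.conj) : IsAlgPt q := by
  obtain ⟨φ, -, rfl⟩ := Finset.mem_image.mp hq
  exact ⟨P.presConj φ⟩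

/-- **Conjugates have the same absolute height.** [cite: NguyenRoy2016, §4] -/
theorem habs_of_mem_conj {q : PPt} (hq : q ∈ P.conj) : habs q = habs P.1 := by
  obtain ⟨φ, -, rfl⟩ := Finset.mem_image.mp hq
  rw [habs_eq (P.presConj φ), P.habs_eq_logHeight_ap, NFPres.habs]
  rfl

end AlgPt

/-! ### Points at projective distance zero -/

/-- Vectors with all `2 × 2` minors zero are proportional. [folklore] -/
theorem mk_eq_mk_of_minors_eq_zero {v w : V3} (hv : v ≠ 0) (hw : w ≠ 0)
    (h : ∀ i j, v i * w j = v j * w i) :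
    Projectivization.mk ℂ v hv = Projectivization.mk ℂ w hw := by
  obtain ⟨k, hk⟩ : ∃ k, v k ≠ 0 := by
    by_contra hcon
    push Not at hcon
    exact hv (funext hcon)
  have hwk : w k ≠ 0 := by
    intro hwk
    apply hw
    funext j
    have := h k j
    rw [hwk, mul_zero] at this
    exact (mul_eq_zero.mp this).resolve_left hk
  rw [Projectivization.mk_eq_mk_iff']
  refine ⟨v k / w k, funext fun j => ?_⟩
  simp only [Pi.smul_apply, smul_eq_mul]
  rw [div_mul_eq_mul_div, div_eq_iff hwk]
  exact h k j

/-- **Points at projective distance `0` coincide.** [folklore] -/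
theorem eq_of_pdist_eq_zero {a b : PPt} (h : pdist a b = 0) : a = b := by
  have key : ∀ i j, a.rep i * b.rep j = a.rep j * b.rep i := by
    intro i j
    have h1 := norm_minor_le_projDist_mul a.rep_nonzero b.rep_nonzero i j
    rw [show projDist a.rep b.rep = 0 from h, zero_mul] at h1
    exact sub_eq_zero.mp (norm_le_zero_iff.mp h1)
  rw [← Projectivization.mk_rep a, ← Projectivization.mk_rep b]
  exact mk_eq_mk_of_minors_eq_zero a.rep_nonzero b.rep_nonzero key

/-- Distinct points are at positive projective distance. [folklore] -/
theorem pdist_pos_of_ne {a b : PPt} (h : a ≠ b) : 0 < pdist a b :=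
  lt_of_le_of_ne (pdist_nonneg a b) fun h0 => h (eq_of_pdist_eq_zero h0.symm)

/-! ### Conjugates computed from other coordinates -/

/-- A ring homomorphism of fields applied to a non-zero vector gives a non-zero vector. [folklore] -/
theorem map_vec_ne_zero {E : Type*} [Field E] (φ : E →+* ℂ) {u : Fin 3 → E} (hu : u ≠ 0) :
    (fun j => φ (u j)) ≠ 0 := fun h => hu (funext fun j => by
  have := congrFun h j
  exact (map_eq_zero_iff φ φ.injective).mp this)

/-- A non-zero vector of `E³ ⊆ ℂ³` is non-zero in `E³`. [folklore] -/
theorem vec_ne_zero_of_coe {E : IntermediateField ℚ ℂ} {b : Fin 3 → E}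
    (hb : (fun j => ((b j : E) : ℂ)) ≠ 0) : b ≠ 0 := fun h => hb (by subst h; funext j; simp)

namespace AlgPt

variable (P : AlgPt)

/-- **The conjugates from other coordinates.** If `b ∈ E³` are homogeneous coordinates of `P` over
a finite extension `E ⊆ ℂ` of `ℚ` with `E ⊆ ℚ(P)` (hence `E = ℚ(P)`), then
`conj P = {[φ(b)] : φ : E → ℂ}`. [cite: NguyenRoy2016, §4] -/
theorem conj_eq_image {E : IntermediateField ℚ ℂ} [FiniteDimensional ℚ E] (b : Fin 3 → E)
    (hb : (fun j => ((b j : E) : ℂ)) ≠ 0) (hbP : Projectivization.mk ℂ _ hb = P.1)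
    (hE : E ≤ Kp P.1) :
    P.conj = Finset.univ.image fun φ : E →ₐ[ℚ] ℂ =>
      Projectivization.mk ℂ (fun j => φ (b j)) (map_vec_ne_zero φ.toRingHom (vec_ne_zero_of_coe hb)) := by
  -- the pivot `k` and `nv P = b / b_k`
  set k : Fin 3 := pivot (fun j => ((b j : E) : ℂ)) with hk
  have hbk : ((b k : E) : ℂ) ≠ 0 := apply_pivot_ne_zero hb
  have hbk' : (b k : E) ≠ 0 := fun h => hbk (by rw [h]; rfl)
  have hnv : ∀ j, nv P.1 j = ((b j : E) : ℂ) / ((b k : E) : ℂ) := fun j => by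
    have := (nv_mk hb).1
    rw [hbP] at this
    rw [this]
    rfl
  -- `ℚ(P) ≤ E`
  have hKE : Kp P.1 ≤ E := by
    refine IntermediateField.adjoin_le_iff.mpr ?_
    rintro x ⟨j, rfl⟩
    rw [hnv]
    exact div_mem (b j).2 (b k).2
  -- the relations between `ap P` and `b` inside `Kp P` and inside `E`
  have hrel1 : ∀ j, IntermediateField.inclusion hE (b j) =
      IntermediateField.inclusion hE (b k) * ap P.1 j := fun j => by
    apply Subtype.ext
    change ((b j : E) : ℂ) = ((b k : E) : ℂ) * nv P.1 j
    rw [hnv, mul_div_cancel₀ _ hbk]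
  have hrel2 : ∀ j, IntermediateField.inclusion hKE (ap P.1 j) = b j / b k := fun j => by
    apply Subtype.ext
    change nv P.1 j = (((b j / b k : E)) : ℂ)
    rw [hnv]
    simp
  ext q
  simp only [conj, Finset.mem_image, Finset.mem_univ, true_and, embPt]
  constructor
  · rintro ⟨ψ, rfl⟩
    refine ⟨ψ.comp (IntermediateField.inclusion hE), ?_⟩
    rw [Projectivization.mk_eq_mk_iff']
    refine ⟨ψ (IntermediateField.inclusion hE (b k)), funext fun j => ?_⟩
    have h1 := congrArg ψ (hrel1 j)
    rw [map_mul] at h1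
    simp only [Pi.smul_apply, smul_eq_mul, AlgHom.coe_comp, Function.comp_apply]
    exact h1.symm
  · rintro ⟨φ, rfl⟩
    refine ⟨φ.comp (IntermediateField.inclusion hKE), ?_⟩
    rw [Projectivization.mk_eq_mk_iff']
    refine ⟨(φ (b k))⁻¹, funext fun j => ?_⟩
    have h2 := congrArg φ (hrel2 j)
    rw [map_div₀, div_eq_inv_mul] at h2
    simp only [Pi.smul_apply, smul_eq_mul, AlgHom.coe_comp, Function.comp_apply]
    exact h2.symm

end AlgPt

/-! ### Translates of algebraic points -/

section translate

variable (r s : ℚ)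

/-- `(s : ℂ) ≠ 0` for `s ≠ 0`. [folklore] -/
theorem cast_ne_zero' {s : ℚ} (hs : s ≠ 0) : (s : ℂ) ≠ 0 := by exact_mod_cast hs

/-- The translation `τⁱ` of `ℙ²(ℂ)` for rational parameters `r, s`. [cite: NguyenRoy2016, §2] -/
def tauQ {s : ℚ} (hs : s ≠ 0) (i : ℤ) : PPt → PPt := tauP (r : ℂ) (cast_ne_zero' hs) i

variable {s}

/-- A ring homomorphism into `ℂ` commutes with `τ̲ⁱ`: `φ(τ̲ⁱ a) = τ̲ⁱ φ(a)`. [folklore] -/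
theorem map_tauVecK (hs : s ≠ 0) {K : Type*} [Field K] [CharZero K] {F : Type*} [FunLike F K ℂ]
    [RingHomClass F K ℂ] (φ : F) (i : ℤ) (a : Fin 3 → K) :
    (fun j => φ (tauVecK r s i a j)) = tauMat (r : ℂ) (s : ℂ) ^ i *ᵥ fun j => φ (a j) := by
  rw [tauMat_zpow _ (cast_ne_zero' hs) i, tauMatPow_mulVec]
  funext j
  fin_cases j
  · simp [tauVecK]
  · simp [tauVecK, map_ratCast]
  · simp [tauVecK, map_ratCast]

/-- `τ̲ⁱ (nv p) ≠ 0`. [folklore] -/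
theorem tauMat_zpow_mulVec_nv_ne_zero (hs : s ≠ 0) (i : ℤ) (p : PPt) :
    tauMat (r : ℂ) (s : ℂ) ^ i *ᵥ nv p ≠ 0 := fun h =>
  nv_ne_zero p (tauMat_zpow_mulVec_injective (r : ℂ) (cast_ne_zero' hs) i (by simpa using h))

/-- `τⁱ p = [τ̲ⁱ (nv p)]`. [cite: NguyenRoy2016, §2] -/
theorem tauQ_eq_mk (hs : s ≠ 0) (i : ℤ) (p : PPt) :
    tauQ r hs i p = Projectivization.mk ℂ (tauMat (r : ℂ) (s : ℂ) ^ i *ᵥ nv p)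
      (tauMat_zpow_mulVec_nv_ne_zero r hs i p) := by
  conv_lhs => rw [← mk_nv p]
  rw [tauQ, tauP_mk]

namespace AlgPt

variable (P : AlgPt)

/-- The presentation `(ℚ(P), ⊆, τ̲ⁱ(ap P))` of `τⁱP`. [folklore] -/
def presTau (hs : s ≠ 0) (i : ℤ) : NFPres (tauQ r hs i P.1) :=
  { K := Kp P.1, ι := algebraMap (Kp P.1) ℂ, a := tauVecK r s i (ap P.1),
    ne_zero := by
      rw [map_tauVecK r hs]
      simpa using tauMat_zpow_mulVec_nv_ne_zero r hs i P.1
    mk_eq := by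
      rw [tauQ_eq_mk]
      apply mk_congr
      rw [map_tauVecK r hs]
      simp }

/-- `τⁱ` of an algebraic point is algebraic. [cite: NguyenRoy2016, §4 (τZ)] -/
theorem isAlgPt_tauQ (hs : s ≠ 0) (i : ℤ) : IsAlgPt (tauQ r hs i P.1) := ⟨P.presTau r hs i⟩

/-- **The translate `τⁱP` of an algebraic point.** [cite: NguyenRoy2016, §4 (τZ)] -/
def tauA (hs : s ≠ 0) (i : ℤ) : AlgPt := ⟨tauQ r hs i P.1, P.isAlgPt_tauQ r hs i⟩

/-- `(τⁱP : ℙ²) = τⁱ(P : ℙ²)`. [folklore] -/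
@[simp] theorem tauA_val (hs : s ≠ 0) (i : ℤ) : (P.tauA r hs i).1 = tauQ r hs i P.1 := rfl

/-- The pivot coordinate of `τ̲ⁱ(nv p)` is a non-zero rational (`1` or `sⁱ`). [folklore] -/
theorem exists_rat_pivot_tauMat (hs : s ≠ 0) (i : ℤ) (p : PPt) :
    ∃ q : ℚ, q ≠ 0 ∧ (tauMat (r : ℂ) (s : ℂ) ^ i *ᵥ nv p) (pivot (tauMat (r : ℂ) (s : ℂ) ^ i *ᵥ nv p))
      = (q : ℂ) := by
  have hsC := cast_ne_zero' hs
  rw [tauMat_zpow _ hsC i, tauMatPow_mulVec]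
  have hrep := p.rep_nonzero
  rcases pivot_cases p.rep with ⟨h, h0⟩ | ⟨h, h0, h1⟩ | ⟨h, h0, h1⟩
  · -- pivot 0: `nv p 0 = 1`
    have hn0 : nv p 0 = 1 := by have := nv_piv p; rwa [piv, h] at this
    refine ⟨1, one_ne_zero, ?_⟩
    simp [pivot, hn0]
  · -- pivot 1: `nv p 0 = 0`, `nv p 1 = 1`
    have hn0 : nv p 0 = 0 := by simp [nv, nrm, h0]
    have hn1 : nv p 1 = 1 := by have := nv_piv p; rwa [piv, h] at this
    refine ⟨1, one_ne_zero, ?_⟩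
    simp [pivot, hn0, hn1]
  · -- pivot 2: `nv p = (0, 0, 1)`
    have hn0 : nv p 0 = 0 := by simp [nv, nrm, h0]
    have hn1 : nv p 1 = 0 := by simp [nv, nrm, h1]
    have hn2 : nv p 2 = 1 := by have := nv_piv p; rwa [piv, h] at this
    refine ⟨s ^ i, zpow_ne_zero _ hs, ?_⟩
    simp [pivot, hn0, hn1, hn2]

/-- **`τ̲ⁱ(nv P) = q · nv(τⁱP)`** with a non-zero rational `q`. [folklore] -/
theorem exists_rat_smul_nv_tauA (hs : s ≠ 0) (i : ℤ) :
    ∃ q : ℚ, q ≠ 0 ∧ tauMat (r : ℂ) (s : ℂ) ^ i *ᵥ nv P.1 = (q : ℂ) • nv (P.tauA r hs i).1 := by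
  obtain ⟨q, hq, hpiv⟩ := exists_rat_pivot_tauMat r hs i P.1
  refine ⟨q, hq, ?_⟩
  rw [tauA_val, tauQ_eq_mk, (nv_mk _).1, ← hpiv, smul_nrm (tauMat_zpow_mulVec_nv_ne_zero r hs i P.1)]

/-- **`ℚ(P) ⊆ ℚ(τⁱP)`** (in fact equal): the coordinates of `nv P` are `ℚ`-linear combinations of
those of `nv(τⁱP)`. [cite: NguyenRoy2016, §4 (τZ is defined over ℚ)] -/
theorem Kp_le_Kp_tauA (hs : s ≠ 0) (i : ℤ) : Kp P.1 ≤ Kp (P.tauA r hs i).1 := by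
  obtain ⟨q, hq, hrel⟩ := P.exists_rat_smul_nv_tauA r hs i
  set w := nv (P.tauA r hs i).1 with hw
  have hmem : ∀ j, w j ∈ Kp (P.tauA r hs i).1 := fun j =>
    IntermediateField.subset_adjoin _ _ ⟨j, rfl⟩
  have hrat : ∀ t : ℚ, (t : ℂ) ∈ Kp (P.tauA r hs i).1 := fun t => by
    have := IntermediateField.algebraMap_mem (Kp (P.tauA r hs i).1) t
    rwa [eq_ratCast] at this  -- `algebraMap ℚ ℂ t = t`
  rw [tauMat_zpow _ (cast_ne_zero' hs) i, tauMatPow_mulVec] at hrel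
  have e0 : nv P.1 0 = (q : ℂ) * w 0 := by
    have := congrFun hrel 0; simpa using this
  have e1 : (i : ℂ) * (r : ℂ) * nv P.1 0 + nv P.1 1 = (q : ℂ) * w 1 := by
    have := congrFun hrel 1; simpa using this
  have e2 : (s : ℂ) ^ i * nv P.1 2 = (q : ℂ) * w 2 := by
    have := congrFun hrel 2; simpa using this
  have hsC := cast_ne_zero' hs
  refine IntermediateField.adjoin_le_iff.mpr ?_
  rintro x ⟨j, rfl⟩
  fin_cases j
  · change nv P.1 0 ∈ _
    rw [e0]
    exact mul_mem (hrat q) (hmem 0)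
  · change nv P.1 1 ∈ _
    have : nv P.1 1 = (q : ℂ) * w 1 - (i : ℂ) * (r : ℂ) * ((q : ℂ) * w 0) := by
      rw [← e0]; linear_combination e1
    rw [this]
    refine sub_mem (mul_mem (hrat q) (hmem 1)) (mul_mem (mul_mem ?_ (hrat r)) (mul_mem (hrat q) (hmem 0)))
    have := hrat (i : ℚ)
    rwa [Rat.cast_intCast] at this
  · change nv P.1 2 ∈ _
    have : nv P.1 2 = ((s ^ i)⁻¹ : ℚ) * ((q : ℂ) * w 2) := by
      rw [← e2]; push_cast; field_simp
    rw [this]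
    exact mul_mem (hrat _) (mul_mem (hrat q) (hmem 2))

/-- **The points of `τⁱZ` are the translates of the points of `Z`:**
`conj (τⁱP) = τⁱ(conj P)`. [cite: NguyenRoy2016, §4 (τZ)] -/
theorem conj_tauA (hs : s ≠ 0) (i : ℤ) :
    (P.tauA r hs i).conj = P.conj.image (tauQ r hs i) := by
  have hb : (fun j => ((tauVecK r s i (ap P.1) j : Kp P.1) : ℂ)) ≠ 0 := (P.presTau r hs i).ne_zero
  have h := (P.tauA r hs i).conj_eq_image (E := Kp P.1) (tauVecK r s i (ap P.1)) hb
    (P.presTau r hs i).mk_eq (P.Kp_le_Kp_tauA r hs i)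
  rw [h, conj, Finset.image_image]
  apply Finset.image_congr
  intro φ _
  simp only [Function.comp_apply, embPt, tauQ, tauP_mk]
  apply mk_congr
  exact map_tauVecK r hs φ i (ap P.1)

/-- `b ∈ conj (τⁱP) ↔ b = τⁱa` for some `a ∈ conj P`. [cite: NguyenRoy2016, §4] -/
theorem mem_conj_tauA (hs : s ≠ 0) (i : ℤ) (b : PPt) :
    b ∈ (P.tauA r hs i).conj ↔ ∃ a ∈ P.conj, tauQ r hs i a = b := by
  rw [conj_tauA, Finset.mem_image]

/-- `τ⁰ = id`, `τⁱτʲ = τⁱ⁺ʲ` on `ℙ²`. [folklore] -/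
theorem tauQ_zero (hs : s ≠ 0) (a : PPt) : tauQ r hs 0 a = a := tauP_zero _ _ a

/-- `τⁱ(τʲ a) = τⁱ⁺ʲ a`. [folklore] -/
theorem tauQ_tauQ (hs : s ≠ 0) (i j : ℤ) (a : PPt) :
    tauQ r hs i (tauQ r hs j a) = tauQ r hs (i + j) a := tauP_tauP _ _ i j a

/-- `τⁱ` is injective on `ℙ²(ℂ)`. [folklore] -/
theorem tauQ_injective (hs : s ≠ 0) (i : ℤ) : Function.Injective (tauQ r hs i) := by
  intro a b h
  have := congrArg (tauQ r hs (-i)) h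
  rwa [tauQ_tauQ, tauQ_tauQ, neg_add_cancel, tauQ_zero, tauQ_zero] at this

/-- **`deg (τⁱP) = deg P`.** [cite: NguyenRoy2016, §4 (deg τZ = deg Z)] -/
theorem deg_tauA (hs : s ≠ 0) (i : ℤ) : (P.tauA r hs i).deg = P.deg := by
  rw [← (P.tauA r hs i).card_conj, ← P.card_conj, P.conj_tauA r hs i,
    Finset.card_image_of_injective _ (tauQ_injective r hs i)]

/-- `τ⁰P = P`, `τⁱ(τʲP) = τⁱ⁺ʲP` for algebraic points. [folklore] -/
theorem tauA_zero (hs : s ≠ 0) : P.tauA r hs 0 = P := Subtype.ext (tauQ_zero r hs P.1)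

/-- `τⁱ(τʲP) = τⁱ⁺ʲP`. [folklore] -/
theorem tauA_tauA (hs : s ≠ 0) (i j : ℤ) : (P.tauA r hs j).tauA r hs i = P.tauA r hs (i + j) :=
  Subtype.ext (tauQ_tauQ r hs i j P.1)

end AlgPt

end translate

end NguyenRoy

end Literature.NumberTheory.Transcendental

end
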